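import Mathlib
import HarnessLib.Audit
import Summits.PneNP.PneNP.Theorems.PstarSlackAssemblyTwo
import Summits.PneNP.PneNP.Theorems.PstarCentreTwoDirty

/-!
# The census node past slack two and two dirty chords (ROUND-24, O1; memo g25 §51.2)

FRONTIER range-avoidance ladder, rung F-N3, ROUND 24 (cell `pnp-ideate`, prover-2 memo `g25/O1-XORSPLIT-g25.md` §50–51; typed targets
`PstarCoreBoundTargets.TerminalFive` / `TerminalPeelable` (p646951); restricted-model proof complexity — nothing here bears on `P` versus `NP`).

Inside the core-bound induction an X-connected terminal core with a centre has boundary slack `t = 2·#bdry − 3·#core ≥ 3`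
(`PstarSlackAssembly.no_centre_at_slack_zero`, `PstarSlackOneCentre.no_centre_at_slack_one`, `PstarSlackTwoClean.no_centre_at_slack_two`) AND two
distinct dirty chords (`PstarCentreTwoDirty.exists_two_dirty_of_centre`, every slack).  The census node shrinks accordingly:
**`MenuCriterionBoundTwoDirty`** = `MenuCriterionBound` restricted to the terminal cores with a centre that are not X-connected, or have slack at least
three together with two distinct chords that are not outside-gated; `terminalFive_of_menuBoundTwoDirty : TerminalFiveA → node → TerminalFive`,
`terminalPeelable_of_menuBoundTwoDirty`, and the comparison `menuCriterionBoundTwoDirty_of_slackTwoClean`.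
-/

set_option linter.dupNamespace false -- `Summit.PneNP.PneNP.…`: summit = sub-problem name (D-0017 single-conjunct layout)

open Finset Literature.Computability.Complexity
open Summit.PneNP.PneNP.Theorems.PstarTyped (Typed)
open Summit.PneNP.PneNP.Theorems.PstarSALevel (varSet bdry BoundaryExpanding SimpleOverlap)
open Summit.PneNP.PneNP.Theorems.PstarXCore (xverts)
open Summit.PneNP.PneNP.Theorems.PstarCoreBound (XorClosed)
open Summit.PneNP.PneNP.Theorems.PstarChordRepair (IsChord)
open Summit.PneNP.PneNP.Theorems.PstarCoreBoundTargets (Terminal TerminalFive TerminalFiveA TerminalPeelable nonchords nonchords_subset mem_nonchords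
  terminalPeelable_of_terminalFive)
open Summit.PneNP.PneNP.Theorems.PstarSharingBound (sharedSlots)
open Summit.PneNP.PneNP.Theorems.PstarChordBridgeTools (xpdeg)
open Summit.PneNP.PneNP.Theorems.PstarChordBridgeCentre (exists_maximal_peelable_sup)
open Summit.PneNP.PneNP.Theorems.PstarChordReadOutside (OutsideGated)
open Summit.PneNP.PneNP.Theorems.PstarSliceGenericCriterion (NoShortCoincidence)
open Summit.PneNP.PneNP.Theorems.PstarCleanChordCount (exists_clean_chords)
open Summit.PneNP.PneNP.Theorems.PstarTerminalPeelableTwelve (exists_centre_of_not_peelable)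
open Summit.PneNP.PneNP.Theorems.PstarNoFreeVertex (Covered covered_of_terminal)
open Summit.PneNP.PneNP.Theorems.PstarHangingForest (Anchored anchored_of_terminal)
open Summit.PneNP.PneNP.Theorems.PstarCleanCut (smallCriterion_of_crossing)
open Summit.PneNP.PneNP.Theorems.PstarCleanCutAssembly (false_of_cleanCut_two SkConnected NoTwoCrossings)
open Summit.PneNP.PneNP.Theorems.PstarTwoCleanExact (MenuGeneric false_of_two_clean_exact)
open Summit.PneNP.PneNP.Theorems.PstarMenuCriterion (NoSmallPathSumSubcoreExact channelMenus subset_of_mem_channelMenus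
  noSmallPathSumSubcoreExact_of_subset noShortCoincidence_anti menuGeneric_of_criterion)
open Summit.PneNP.PneNP.Theorems.PstarSkeletonSpan (XConnected)
open Summit.PneNP.PneNP.Theorems.PstarSlackOneCentre (no_centre_at_slack_one)
open Summit.PneNP.PneNP.Theorems.PstarSlackAssembly (no_centre_at_slack_zero)
open Summit.PneNP.PneNP.Theorems.PstarSlackAssemblyTwo (MenuCriterionBoundSlackTwoClean)
open Summit.PneNP.PneNP.Theorems.PstarSlackTwoClean (no_centre_at_slack_two)
open Summit.PneNP.PneNP.Theorems.PstarCentreTwoDirty (exists_two_dirty_of_centre)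

namespace Summit.PneNP.PneNP.Theorems.PstarDirtyAssembly

variable {n m : ℕ}

/-- **`MenuCriterionBoundTwoDirty` (OPEN, census-type)**: `MenuCriterionBound` restricted to the terminal cores with a centre that are not
X-connected, or have boundary slack at least three (`3·#J₀ + 3 ≤ 2·#bdry J₀`) and two distinct chords that are not outside-gated.  FRONTIER. -/
@[conjecture] def MenuCriterionBoundTwoDirty : Prop :=
  ∀ (n m r : ℕ) (I : LocalMap 4 n m), I.IsPure xorAndPred → Typed I → SimpleOverlap I → BoundaryExpanding r I →
    ∀ (y : Fin m → Bool) (J₀ : Finset (Fin m)) (w₁ w₂ : Finset (Fin n) × Finset (Fin m) × Bool), Terminal I r y J₀ w₁ w₂ →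
      (∃ S ⊆ J₀, S.Nonempty ∧ (∀ w ∈ xverts I S, 2 ≤ xpdeg I S w) ∧ ∀ f ∈ S, ¬ IsChord I J₀ f) →
      Covered I J₀ (w₁.2.1 ∪ w₂.2.1) → Anchored I J₀ (w₁.2.1 ∪ w₂.2.1) → NoTwoCrossings I J₀ (w₁.2.1 ∪ w₂.2.1) →
      (XConnected I J₀ → 3 * J₀.card + 3 ≤ 2 * (bdry I J₀).card ∧
        ∃ d₁ ∈ J₀, ∃ d₂ ∈ J₀, d₁ ≠ d₂ ∧ IsChord I J₀ d₁ ∧ ¬ OutsideGated I J₀ (w₁.2.1 ∪ w₂.2.1) d₁ ∧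
          IsChord I J₀ d₂ ∧ ¬ OutsideGated I J₀ (w₁.2.1 ∪ w₂.2.1) d₂) →
      ∃ ℬ ⊆ J₀, ℬ.card + 2 ≤ (sharedSlots I J₀).card ∧
        ∀ c ∈ J₀, c ∉ ℬ → IsChord I J₀ c → OutsideGated I J₀ (w₁.2.1 ∪ w₂.2.1) c → SkConnected I J₀ (w₁.2.1 ∪ w₂.2.1) c →
          ∀ G ∈ channelMenus I J₀ w₁ w₂, NoSmallPathSumSubcoreExact I r y J₀ c G ∧ NoShortCoincidence I J₀ c G

/-- The new node is weaker than `MenuCriterionBoundSlackTwoClean`. -/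
theorem menuCriterionBoundTwoDirty_of_slackTwoClean (h : MenuCriterionBoundSlackTwoClean) : MenuCriterionBoundTwoDirty := by
  intro n m r I hI hT hS hB y J₀ w₁ w₂ ht hc hcov hanc hN2 hx
  exact h n m r I hI hT hS hB y J₀ w₁ w₂ ht hc hcov hanc hN2 fun hconn => Or.inl (hx hconn).1

/-- **THE CORE BOUND FROM O2 AND THE NODE PAST SLACK TWO AND TWO DIRTY CHORDS** — the strong induction of `terminalFive_of_menuBound`, the
X-connected structures of slack `0`, `1`, `2` or with at most one dirty chord excluded by name. -/
theorem terminalFive_of_menuBoundTwoDirty (hO2 : TerminalFiveA) (hb : MenuCriterionBoundTwoDirty) : TerminalFive := by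
  classical
  suffices H : ∀ (k n m r : ℕ) (I : LocalMap 4 n m), I.IsPure xorAndPred → Typed I → SimpleOverlap I → BoundaryExpanding r I →
      ∀ (y : Fin m → Bool) (J₀ : Finset (Fin m)) (w₁ w₂ : Finset (Fin n) × Finset (Fin m) × Bool), Terminal I r y J₀ w₁ w₂ →
        J₀.card = k → J₀.card ≤ 5 from
    fun n m r I hI hT hS hB y J₀ w₁ w₂ ht => H _ n m r I hI hT hS hB y J₀ w₁ w₂ ht rfl
  intro k
  induction k using Nat.strong_induction_on with
  | _ k ih =>
    intro n m r I hI hT hS hB y J₀ w₁ w₂ ht hk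
    by_cases hP : PstarChordBridgeCotree.Peelable I (nonchords I J₀)
    · obtain ⟨F, hS₀F, hFJ, hPF, hmax⟩ := exists_maximal_peelable_sup I (nonchords_subset I J₀) hP
      refine hO2 n m r I hI hT hS hB y J₀ w₁ w₂ ht F hFJ hPF hmax fun e he => ?_
      rw [mem_sdiff] at he
      by_contra hc
      exact he.2 (hS₀F ((mem_nonchords I).2 ⟨he.1, hc⟩))
    · exfalso
      obtain ⟨S, hSJ, hne, hL, hnc⟩ := exists_centre_of_not_peelable I hP
      have hdisj : Disjoint J₀ (w₁.2.1 ∪ w₂.2.1) := disjoint_union_right.2 ⟨ht.2.2.2.1, ht.2.2.2.2.1⟩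
      set 𝒢 := w₁.2.1 ∪ w₂.2.1 with h𝒢
      have hIH : ∀ c ∈ J₀, ∀ K₀ ⊆ J₀.erase c, ∀ d₁ d₂ : Finset (Fin n) × Finset (Fin m) × Bool, Terminal I r y K₀ d₁ d₂ → K₀.card ≤ 5 := by
        intro c hc K₀ hK₀ d₁ d₂ ht₀
        have hlt : K₀.card < k := by
          rw [← hk]
          exact lt_of_le_of_lt (card_le_card hK₀) (card_erase_lt_of_mem hc)
        exact ih K₀.card hlt n m r I hI hT hS hB y K₀ d₁ d₂ ht₀ rfl
      -- the slack layers `0`, `1`, `2` of X-connected cores carry no centre, and a centre forces two dirty chords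
      have hslack : XConnected I J₀ → 3 * J₀.card + 3 ≤ 2 * (bdry I J₀).card ∧
          ∃ d₁ ∈ J₀, ∃ d₂ ∈ J₀, d₁ ≠ d₂ ∧ IsChord I J₀ d₁ ∧ ¬ OutsideGated I J₀ (w₁.2.1 ∪ w₂.2.1) d₁ ∧
            IsChord I J₀ d₂ ∧ ¬ OutsideGated I J₀ (w₁.2.1 ∪ w₂.2.1) d₂ := by
        intro hconn
        refine ⟨?_, exists_two_dirty_of_centre hI hT hS hB ht hIH hconn ⟨S, hSJ, hne, hL, hnc⟩⟩
        have hexp : 3 * J₀.card ≤ 2 * (bdry I J₀).card := hB J₀ ht.2.2.1.le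
        by_contra h3
        by_cases h0 : 2 * (bdry I J₀).card = 3 * J₀.card
        · exact no_centre_at_slack_zero hI hT hS hB ht hIH hconn h0 ⟨S, hSJ, hne, hL, hnc⟩
        by_cases h1 : 2 * (bdry I J₀).card = 3 * J₀.card + 1
        · exact no_centre_at_slack_one hI hT hS hB ht hIH hconn h1 ⟨S, hSJ, hne, hL, hnc⟩
        have h2 : 2 * (bdry I J₀).card = 3 * J₀.card + 2 := by omega
        exact no_centre_at_slack_two hI hT hS hB ht hIH hconn h2 ⟨S, hSJ, hne, hL, hnc⟩
      have hN2 : NoTwoCrossings I J₀ 𝒢 := fun W e₁ e₂ he₁ he₂ hne hc₁ hc₂ hcut =>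
        false_of_cleanCut_two hI hT hS hB ht hIH hcut he₁ he₂ hne hc₁ hc₂
      obtain ⟨ℬ, -, hℬ, hgood⟩ := hb n m r I hI hT hS hB y J₀ w₁ w₂ ht ⟨S, hSJ, hne, hL, hnc⟩ (covered_of_terminal hI hT hS hB ht)
        (anchored_of_terminal hI hT hS hB ht) hN2 hslack
      obtain ⟨𝒞, h𝒞J, hch, hO, hcard⟩ := exists_clean_chords hB ht
      have hU : 1 < (𝒞 \ ℬ).card := by
        have := le_card_sdiff ℬ 𝒞
        omega
      obtain ⟨a, ha, b, hb', hab⟩ := one_lt_card.1 hU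
      obtain ⟨ha𝒞, haℬ⟩ := mem_sdiff.1 ha
      obtain ⟨hb𝒞, hbℬ⟩ := mem_sdiff.1 hb'
      have hcrit : ∀ c ∈ 𝒞, c ∉ ℬ → ∀ G ∈ channelMenus I J₀ w₁ w₂,
          NoSmallPathSumSubcoreExact I r y J₀ c G ∧ NoShortCoincidence I J₀ c G := by
        intro c hc hcℬ G hG
        by_cases hsk : SkConnected I J₀ 𝒢 c
        · exact hgood c (h𝒞J hc) hcℬ (hch c hc) (hO c hc) hsk G hG
        · unfold PstarCleanCutAssembly.SkConnected at hsk
          push Not at hsk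
          obtain ⟨W, hcW, hcut⟩ := hsk
          obtain ⟨hA, hBc⟩ := smallCriterion_of_crossing (y := y) (r := r) hI hT hS hB hdisj (fun f hf hcf => hcut f hf hcf) hcW
          exact ⟨noSmallPathSumSubcoreExact_of_subset hA (subset_of_mem_channelMenus hG),
            noShortCoincidence_anti hBc (subset_of_mem_channelMenus hG)⟩
      have hgen : ∀ c ∈ 𝒞, c ∉ ℬ → MenuGeneric I y J₀ c w₁ w₂ := fun c hc hcℬ =>
        menuGeneric_of_criterion hI hT hS hB ht (h𝒞J hc) (hIH c (h𝒞J hc)) (hcrit c hc hcℬ)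
      exact false_of_two_clean_exact hI hT hS hB ht (h𝒞J ha𝒞) (h𝒞J hb𝒞) hab (hch a ha𝒞) (hch b hb𝒞) (hO a ha𝒞) (hO b hb𝒞)
        (hgen a ha𝒞 haℬ) (hgen b hb𝒞 hbℬ)

/-- **O1 from the same inputs.** -/
theorem terminalPeelable_of_menuBoundTwoDirty (hO2 : TerminalFiveA) (hb : MenuCriterionBoundTwoDirty) : TerminalPeelable :=
  terminalPeelable_of_terminalFive (terminalFive_of_menuBoundTwoDirty hO2 hb)

end Summit.PneNP.PneNP.Theorems.PstarDirtyAssembly
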